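import Literature.AnabelianGeometry.SemiGraphs.GraphOfAnabelioids

/-!
# The branch subgroups `Π_b ⊆ Π_v`: identification lemmas ([SemiAnbd] §2, Def. 2.1, pp. 23–24)

Mochizuki, *Semi-graphs of anabelioids*, Publ. RIMS **42** (2006) 221–322, §2, pp. 23–24
[cite: MochizukiSemiAnbd2006, Def. 2.1 pp.23-24]: "by abuse of notation, we shall write `Π_b ⊆ Π_v`
for the image of `Π_b` in `Π_v` [which is well-defined up to conjugation in `Π_v`]".  API for the
tree's `SemiGraphOfAnabelioids.branchSubgroup F b h Fe α` (`GraphOfAnabelioids.lean`, frozen), asked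
for by the G18 discharge (L3-t12): the branch subgroup is the image of `π₁(b^*) : Π_b → Π_v`
transported along `α`; membership; the basepoint-free case `α = refl`; and a change of `α`
conjugates it ("well-defined up to conjugation").  Proof-only companion (no new notions).
-/

namespace Literature.AnabelianGeometry.SemiGraphs

open CategoryTheory CategoryTheory.PreGaloisCategory
open Literature.AnabelianGeometry.Anabelioids
open scoped Pointwise

universe v₁ u₁ u w

namespace SemiGraphOfAnabelioids

variable (𝒢 : SemiGraphOfAnabelioids.{v₁, u₁, u}) {v : 𝒢.graph.Vertex}
  (F : 𝒢.V v ⥤ FintypeCat.{w}) (b : 𝒢.graph.Branch) (h : 𝒢.graph.abuts b = some v)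
  (Fe : 𝒢.E (𝒢.graph.edgeOf b) ⥤ FintypeCat.{w})

/-- `Π_b ⊆ Π_v` is the image of `π₁(b^*) : Π_b → Π_v` (for the induced basepoint) mapped along the
transport `α`. [cite: MochizukiSemiAnbd2006, Def. 2.1 pp.23-24] -/
theorem branchSubgroup_eq_map_range (α : (𝒢.pull b v h).pullback ⋙ Fe ≅ F) :
    𝒢.branchSubgroup F b h Fe α =
      (𝒢.piBToPiV b v h Fe).range.map (Aut.autMulEquivOfIso α).toMonoidHom :=
  MonoidHom.range_comp _ _

/-- Membership in `Π_b ⊆ Π_v`. [cite: MochizukiSemiAnbd2006, Def. 2.1 pp.23-24] -/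
theorem mem_branchSubgroup_iff (α : (𝒢.pull b v h).pullback ⋙ Fe ≅ F) (x : 𝒢.PiV v F) :
    x ∈ 𝒢.branchSubgroup F b h Fe α ↔
      ∃ σ : 𝒢.PiB b Fe, Aut.autMulEquivOfIso α (𝒢.piBToPiV b v h Fe σ) = x :=
  Iff.rfl

/-- For the induced basepoint `b^* ⋙ F_e` itself (`α = refl`), `Π_b ⊆ Π_v` is literally the range
of `π₁(b^*)`. [cite: MochizukiSemiAnbd2006, Def. 2.1 pp.23-24] -/
theorem branchSubgroup_refl :
    𝒢.branchSubgroup ((𝒢.pull b v h).pullback ⋙ Fe) b h Fe (Iso.refl _) =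
      (𝒢.piBToPiV b v h Fe).range := by
  ext x
  rw [mem_branchSubgroup_iff, MonoidHom.mem_range]
  constructor
  · rintro ⟨σ, rfl⟩
    refine ⟨σ, ?_⟩
    ext : 1
    simp [Aut.autMulEquivOfIso]
  · rintro ⟨σ, rfl⟩
    refine ⟨σ, ?_⟩
    ext : 1
    simp [Aut.autMulEquivOfIso]

/-- The element `α⁻¹ ≫ α'` of `Π_v = Aut F` comparing two transports of basepoints.
[cite: MochizukiSemiAnbd2006, Def. 2.1 pp.23-24] -/
def transportAut {C : Type*} [Category C] {G' F' : C} (α α' : G' ≅ F') : Aut F' := α.symm ≪≫ α'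

/-- Transport along two identifications `α, α'` of basepoints differs by conjugation by
`α⁻¹ ≫ α' ∈ Aut F = Π_v`. [folklore] -/
private theorem autMulEquivOfIso_eq_conj {C : Type*} [Category C] {G' F' : C} (α α' : G' ≅ F')
    (x : Aut G') :
    Aut.autMulEquivOfIso α' x = MulAut.conj (transportAut α α') (Aut.autMulEquivOfIso α x) := by
  ext : 1
  simp [Aut.autMulEquivOfIso, transportAut, MulAut.conj_apply, Aut.Aut_mul_def, Aut.Aut_inv_def]

/-- "Well-defined up to conjugation in `Π_v`": changing the transport `α` to `α'` conjugates the
branch subgroup by `α⁻¹ ≫ α' ∈ Π_v`. [cite: MochizukiSemiAnbd2006, Def. 2.1 pp.23-24] -/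
theorem branchSubgroup_eq_map_conj (α α' : (𝒢.pull b v h).pullback ⋙ Fe ≅ F) :
    𝒢.branchSubgroup F b h Fe α' =
      (𝒢.branchSubgroup F b h Fe α).map (MulAut.conj (transportAut α α')).toMonoidHom := by
  ext x
  simp only [mem_branchSubgroup_iff, Subgroup.mem_map, MulEquiv.coe_toMonoidHom]
  constructor
  · rintro ⟨σ, rfl⟩
    exact ⟨_, ⟨σ, rfl⟩, (autMulEquivOfIso_eq_conj α α' _).symm⟩
  · rintro ⟨_, ⟨σ, rfl⟩, rfl⟩
    exact ⟨σ, autMulEquivOfIso_eq_conj α α' _⟩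

/-- The same, in the pointwise-conjugation form used by `Commensurability.lean`
(`ConjAct.toConjAct g • Π_b`). [cite: MochizukiSemiAnbd2006, Def. 2.1 pp.23-24] -/
theorem branchSubgroup_eq_conjAct_smul (α α' : (𝒢.pull b v h).pullback ⋙ Fe ≅ F) :
    𝒢.branchSubgroup F b h Fe α' =
      ConjAct.toConjAct (transportAut α α') • 𝒢.branchSubgroup F b h Fe α := by
  rw [branchSubgroup_eq_map_conj 𝒢 F b h Fe α α']
  ext x
  rw [Subgroup.mem_map, Subgroup.mem_smul_pointwise_iff_exists]
  simp only [MulEquiv.coe_toMonoidHom, MulAut.conj_apply, ConjAct.smul_def,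
    ConjAct.ofConjAct_toConjAct]

end SemiGraphOfAnabelioids

end Literature.AnabelianGeometry.SemiGraphs
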